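import Summits.BirchSwinnertonDyer.BirchSwinnertonDyer.Theorems.ByReductionTypeAtTwoMultUpperHalfTowerNS2OneBit
import Summits.BirchSwinnertonDyer.BirchSwinnertonDyer.Theorems.ByReductionTypeAtTwoMultTowerNS2OneBitHolds
import HarnessLib

/-!
# Route `ByReductionTypeAtTwo`, crux `MultUpperHalfAtTwo` (item stmt-BirchSwinnertonDyer-19922): the ONE-BIT TOWER-gap door at a
# NON-SPLIT multiplicative `2` with the binder `hNS2one` DISCHARGED by the kernel theorem
# `MultTowerNS2.localTowerKerTwoTorsion_le_two_nonsplitTwo_of_tateUnit_holds`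

HONEST FRAMING (cell `bsd-2adic`, run/shared/lean/pub/bsd-2adic/, seat `bsd-2adic-tower-1` GEN 9, HUMAN RULINGS D-0036 / D-0054 /
D-0074): research route; THEOREMS ONLY; nothing is booked; BSD is not proved by any of this. This is the door
`MultTowerNS2.towerGapAtTwo_of_layerSelmer_cert_nonsplitTwo_oneBit` (`…MultUpperHalfTowerNS2OneBit.lean`, seat mult-2 GEN 7) with its
MEMO hypothesis `hNS2one` REMOVED: the binder is now the tree theorem
`localTowerKerTwoTorsion_le_two_nonsplitTwo_of_tateUnit_holds` (`…MultTowerNS2OneBitHolds.lean`, this seat, scope memo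
HOME/tower/SCOPE-hNS2one-kernel-GEN8.md M1–M7). WHAT IS STILL DISPLAYED, NOT PROVED: PRINT {`h33g`, `hM`, `hA`}; the layer counts
`hlow`/`hup` and the arithmetic `harith` (certificate legs). References: R. Greenberg, LNM 1716 (1999) §3 pp. 85–93.
-/

set_option autoImplicit false
-- the Theorems namespace of this sub repeats the summit name by design (D-0017 nested layout: Summit.<S>.<Sub>)
set_option linter.dupNamespace false

noncomputable section

open scoped Classical

open NumberField IsDedekindDomain WeierstrassCurve Literature.NumberTheory.EllipticCurves
  Literature.NumberTheory.EllipticCurves.Greenberg1999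
  Summit.BirchSwinnertonDyer.Rank1Residual.X5 Summit.BirchSwinnertonDyer.Rank1Residual.X5.O1
  Summit.BirchSwinnertonDyer.Rank1Residual

namespace Summit.BirchSwinnertonDyer.BirchSwinnertonDyer.Theorems.MultTowerNS2

variable (W : WeierstrassCurve ℚ) [W.IsElliptic] [W.IsGloballyMinimal]

/-- **`h2` at a NON-SPLIT multiplicative `2` with ONE bit, UNCONDITIONALLY in `hNS2one`: `C₂ = 2`** at every upper layer `j′ ≥ 1`
for a globally minimal `W/ℚ`, multiplicative non-split at `2`, with Tate-unit datum `(Δ_min/2^k)·c₄ ≡ ±3 (mod 8)` — the kernel theorem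
`localTowerKerTwoTorsion_le_two_nonsplitTwo_of_tateUnit_holds`. [cite: GreenbergLNM1716, §3 pp. 86 and 93] -/
theorem atTwo_le_two_of_nonsplit_oneBit_kernel
    (hmult : W.HasMultiplicativeReductionAtPrime 2) (hns : ¬ W.HasSplitMultiplicativeReductionAtPrime 2)
    (hq : ∃ (k : ℕ) (u c : ℤ), W.minimalDiscriminantInt = 2 ^ k * u ∧ W.c₄ = (c : ℚ) ∧ (u * c % 8 = 3 ∨ u * c % 8 = 5))
    {n : ℕ} (hn : 1 ≤ n) :
    ∀ κ : ZpExtension ℚ 2, κ.IsCyclotomic → ∀ v : HeightOneSpectrum (𝓞 ℚ), ((2 : ℕ) : 𝓞 ℚ) ∈ v.asIdeal →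
      Finite {x : W.localTowerKerPrimary κ (v.adicCompletion ℚ) n // 2 • x = 0} ∧
        Nat.card {x : W.localTowerKerPrimary κ (v.adicCompletion ℚ) n // 2 • x = 0} ≤ 2 :=
  atTwo_le_two_of_nonsplit_oneBit W localTowerKerTwoTorsion_le_two_nonsplitTwo_of_tateUnit_holds hmult hns hq hn

/-- **The ONE-BIT GAP certificate at a NON-SPLIT multiplicative `2`, with `hNS2one` discharged** (`E[2]` irreducible member: odd torsion
order): PRINT {`h33g`, `hM`, `hA`} + the displayed Tate-unit datum + layer counts at `j ≤ j′`, `1 ≤ j′`, with the arithmetic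
`2^d · 2 · ∏_{ℓ ∈ P} C_ℓ^{2^{min(j′, e_ℓ)}} < 2^{2^{j′} − 2^j + a}` ⟹ `O1.TowerGapAtTwo W`
(= `towerGapAtTwo_of_layerSelmer_cert_nonsplitTwo_oneBit` with `hNS2one := localTowerKerTwoTorsion_le_two_nonsplitTwo_of_tateUnit_holds`).
[cite: GreenbergLNM1716, §3 Lemmas 3.3–3.5 (PDF pp. 86–90) and pp. 90–93] [cite: SilvermanAEC2009, VII.1 Prop. 1.3, VII.5.1] -/
theorem towerGapAtTwo_of_layerSelmer_cert_nonsplitTwo_oneBit_kernel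
    (h33g : lemma33_localTowerKerPrimary_eq_bot_of_good.{0})
    (hM : lemma33_localTowerKerPrimary_cyclic_of_multiplicative.{0})
    (hA : lemma33_natCard_localTowerKerPrimary_le_four_of_additive.{0})
    (hmult : W.HasMultiplicativeReductionAtPrime 2) (hns : ¬ W.HasSplitMultiplicativeReductionAtPrime 2)
    (hq : ∃ (k : ℕ) (u c : ℤ), W.minimalDiscriminantInt = 2 ^ k * u ∧ W.c₄ = (c : ℚ) ∧ (u * c % 8 = 3 ∨ u * c % 8 = 5))
    (htors : ¬ 2 ∣ W.torsionOrder) {j j' a d : ℕ} (hjj' : j ≤ j') (hj' : 1 ≤ j')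
    (P : Finset ℕ) (hP : ∀ ℓ ∈ P, ℓ.Prime ∧ ℓ ≠ 2)
    (hΔ : ∀ ℓ : ℕ, ℓ.Prime → ℓ ≠ 2 → (ℓ : ℤ) ∣ W.minimalDiscriminantInt → ℓ ∈ P)
    (C e k : ℕ → ℕ) (he : ∀ ℓ ∈ P, ¬ 2 ^ (e ℓ + 4) ∣ ℓ ^ 2 - 1)
    (hC : ∀ (ℓ : ℕ) [Fact ℓ.Prime], ℓ ∈ P →
      4 ≤ C ℓ ∨ (W.HasMultiplicativeReductionAtPrime ℓ ∧ 2 ≤ C ℓ) ∨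
        (W.HasMultiplicativeReductionAtPrime ℓ ∧ (ℓ : ℤ) ^ k ℓ ∣ W.minimalDiscriminantInt ∧
          ¬ (ℓ : ℤ) ^ (k ℓ + 1) ∣ W.minimalDiscriminantInt ∧ ¬ 2 ∣ k ℓ ∧ 1 ≤ C ℓ) ∨
        (¬ (ℓ : ℤ) ∣ W.minimalDiscriminantInt ∧ 1 ≤ C ℓ))
    (hlow : ∀ κ : ZpExtension ℚ 2, κ.IsCyclotomic →
      2 ^ a ≤ Nat.card {z : W.selmerLayer κ j // 2 • z = 0})
    (hup : ∀ κ : ZpExtension ℚ 2, κ.IsCyclotomic →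
      Nat.card {z : W.selmerLayer κ j' // 2 • z = 0} ≤ 2 ^ d)
    (harith : 2 ^ d * 2 * ∏ ℓ ∈ P, C ℓ ^ 2 ^ min j' (e ℓ) < 2 ^ (2 ^ j' - 2 ^ j + a)) :
    TowerGapAtTwo W :=
  towerGapAtTwo_of_layerSelmer_cert_nonsplitTwo_oneBit W h33g hM hA localTowerKerTwoTorsion_le_two_nonsplitTwo_of_tateUnit_holds
    hmult hns hq htors hjj' hj' P hP hΔ C e k he hC hlow hup harith

end Summit.BirchSwinnertonDyer.BirchSwinnertonDyer.Theorems.MultTowerNS2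

end
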